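import Summits.CriticalPhenomena.CardyFormulaZ2.Theorems.CardyUSTContinuationUniformAnalyticExtensionStubLambdaLiftBall
import Summits.CriticalPhenomena.CardyFormulaZ2.Theorems.CardyUSTContinuationUniformAnalyticExtensionStubLambdaCompactPreimage
import Summits.CriticalPhenomena.CardyFormulaZ2.Theorems.CardyUSTContinuationUniformAnalyticExtensionStubLambdaSmallValues
import Literature.NumberTheory.Automorphic.ModularLambdaSurjective
import Mathlib.Analysis.Complex.Schwarz
import HarnessLib

/-!
# Schottky's theorem (stub `stub_schottky` of the crux `UniformAnalyticExtension`, line `registered`)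

Supports file for item stmt-CriticalPhenomena-6047 (route `CardyUSTContinuation`, sub-problem
`CardyFormulaZ2`), skeleton v5/v6 of lead c4.  **Schottky's theorem** (F. Schottky 1904; Conway,
*Functions of One Complex Variable I*, 2nd ed. (1978), Ch. XII §3; Ahlfors, *Complex Analysis*,
3rd ed., Ch. 8 §3): for all `α` and `r < 1` there is a constant `C = C(α, r)` such that every function
`f` holomorphic on a disc `ball c R` that OMITS the two values `0` and `1` and has `‖f c‖ ≤ α`
satisfies `‖f z‖ ≤ C` for `dist z c ≤ r R`.

We PROVE it from the universal covering `λ : ℍ → ℂ ∖ {0,1}` of the tree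
(`Literature.NumberTheory.Automorphic.ModularLambdaCovering`) through the three landed λ-engine
stubs of the skeleton — `stub_lambdaLiftBall` (holomorphic lifting on discs, p-landed),
`stub_lambdaCompactPreimage` (compact sets of lifts, p153178), `stub_lambdaSmallValues` (the cusp at
`i∞`, p153175) — plus Mathlib's Schwarz lemma: writing `f = λ ∘ F` with `F c = τ₀`, the quotient
`(F - τ₀)/(F - conj τ₀)` maps the disc into the unit disc and vanishes at `c`, so
`‖F z - τ₀‖ ≤ r ‖F z - conj τ₀‖` for `dist z c ≤ r R` (`schottky_exists_confined_preimage`), which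
confines `F z` to the hyperbolic disc of radius `artanh r` about `τ₀`
(`schottky_confine_of_le`: `(1 - r) Im τ₀ ≤ (1 + r) Im (F z)`, `‖F z‖ (1 - r) ≤ ‖τ₀‖ (1 + r)`).  If
`f c` (or `1 - f c`) is within `ε'` of `0`, the lift starts above a height `B` and `F z` stays above
the height where `‖λ‖ < 1`, giving `‖f z‖ < 2`; otherwise `f c` lies in a compact
`K ⊆ ℂ ∖ {0,1}`, `τ₀` in a compact `K' ⊆ ℍ`, `F z` in a compact `K₂ ⊆ ℍ`, and `‖f z‖ ≤ max_{K₂} ‖λ‖`.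
In the skeleton, Schottky bounds the crossing ratio `u_δ = N_δ/Z_δ` (which omits `0` and `1` where
`Z_δ, N_δ, N^c_δ ≠ 0` and is `≤ 1` at real points) by the universal `C(1, 1/2)`.
-/

noncomputable section

open Filter Topology Set Metric Complex
open Literature.NumberTheory.Automorphic (modularLambda)
open Literature.NumberTheory.Automorphic.ModularLambda

namespace Summit.CriticalPhenomena.CardyFormulaZ2.Cruxes.UniformAnalyticExtension.Birth

/-! ### Schwarz–Pick confinement of a lift -/

/-- For `τ, τ₀` in the upper half-plane, `‖τ - τ₀‖ ≤ ‖τ - conj τ₀‖`. [folklore] -/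
theorem schottky_norm_sub_le_norm_sub_conj {τ τ₀ : ℂ} (hτ : 0 < τ.im) (hτ₀ : 0 < τ₀.im) :
    ‖τ - τ₀‖ ≤ ‖τ - (starRingEnd ℂ) τ₀‖ := by
  have key : ‖τ - τ₀‖ ^ 2 ≤ ‖τ - (starRingEnd ℂ) τ₀‖ ^ 2 := by
    rw [Complex.sq_norm, Complex.sq_norm, Complex.normSq_apply, Complex.normSq_apply]
    simp only [sub_re, sub_im, Complex.conj_re, Complex.conj_im]
    nlinarith
  exact (sq_le_sq₀ (norm_nonneg _) (norm_nonneg _)).1 key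

/-- **Hyperbolic confinement.** If `‖τ - τ₀‖ ≤ r ‖τ - conj τ₀‖` with `0 ≤ r < 1` and `τ, τ₀ ∈ ℍ`,
then `(1 - r) Im τ₀ ≤ (1 + r) Im τ` and `‖τ‖ (1 - r) ≤ ‖τ₀‖ (1 + r)`. [folklore] -/
theorem schottky_confine_of_le {τ τ₀ : ℂ} {r : ℝ} (hτ : 0 < τ.im) (hτ₀ : 0 < τ₀.im) (hr0 : 0 ≤ r)
    (h : ‖τ - τ₀‖ ≤ r * ‖τ - (starRingEnd ℂ) τ₀‖) :
    (1 - r) * τ₀.im ≤ (1 + r) * τ.im ∧ ‖τ‖ * (1 - r) ≤ ‖τ₀‖ * (1 + r) := by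
  constructor
  · -- imaginary parts: `|Im τ - Im τ₀| ≤ r (Im τ + Im τ₀)`
    have h1 : |τ.im - τ₀.im| ≤ ‖τ - τ₀‖ := by
      simpa [sub_im] using Complex.abs_im_le_norm (τ - τ₀)
    have h2 : ‖τ - (starRingEnd ℂ) τ₀‖ ^ 2 = (τ.re - τ₀.re) ^ 2 + (τ.im + τ₀.im) ^ 2 := by
      rw [Complex.sq_norm, Complex.normSq_apply]
      simp only [sub_re, sub_im, Complex.conj_re, Complex.conj_im]
      ring
    have h3 : ‖τ - τ₀‖ ^ 2 = (τ.re - τ₀.re) ^ 2 + (τ.im - τ₀.im) ^ 2 := by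
      rw [Complex.sq_norm, Complex.normSq_apply]
      simp only [sub_re, sub_im]
      ring
    have h4 : ‖τ - τ₀‖ ^ 2 ≤ r ^ 2 * ‖τ - (starRingEnd ℂ) τ₀‖ ^ 2 := by
      have := mul_self_le_mul_self (norm_nonneg _) h
      nlinarith [this]
    have h5 : (τ.im - τ₀.im) ^ 2 ≤ (r * (τ.im + τ₀.im)) ^ 2 := by
      rw [h2, h3] at h4
      rcases le_or_gt (r ^ 2) 1 with hr1 | hr1
      · have hA : 0 ≤ (τ.re - τ₀.re) ^ 2 := sq_nonneg _
        have : (r ^ 2 - 1) * (τ.re - τ₀.re) ^ 2 ≤ 0 :=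
          mul_nonpos_of_nonpos_of_nonneg (by linarith) hA
        nlinarith [this, h4]
      · have hD : (τ.im - τ₀.im) ^ 2 ≤ (τ.im + τ₀.im) ^ 2 := by nlinarith
        have hS : 0 ≤ (τ.im + τ₀.im) ^ 2 := sq_nonneg _
        calc (τ.im - τ₀.im) ^ 2 ≤ (τ.im + τ₀.im) ^ 2 := hD
          _ = 1 * (τ.im + τ₀.im) ^ 2 := (one_mul _).symm
          _ ≤ r ^ 2 * (τ.im + τ₀.im) ^ 2 := by gcongr
          _ = (r * (τ.im + τ₀.im)) ^ 2 := by ring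
    have h6 : |τ.im - τ₀.im| ≤ r * (τ.im + τ₀.im) := by
      have hnn : 0 ≤ r * (τ.im + τ₀.im) := mul_nonneg hr0 (by linarith)
      exact abs_le_of_sq_le_sq' h5 hnn |> fun h => abs_le.2 h
    have h7 := (abs_le.1 h6).1
    nlinarith
  · -- norms: `‖τ - conj τ₀‖ ≤ ‖τ - τ₀‖ + 2 Im τ₀`
    have hconj : ‖τ₀ - (starRingEnd ℂ) τ₀‖ = 2 * τ₀.im := by
      rw [Complex.sub_conj]
      simp [abs_of_pos hτ₀]
    have h1 : ‖τ - (starRingEnd ℂ) τ₀‖ ≤ ‖τ - τ₀‖ + 2 * τ₀.im := by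
      rw [← hconj]
      exact norm_sub_le_norm_sub_add_norm_sub _ _ _
    have h2 : ‖τ - τ₀‖ * (1 - r) ≤ 2 * r * τ₀.im := by nlinarith [norm_nonneg (τ - τ₀)]
    have h3 : τ₀.im ≤ ‖τ₀‖ := by
      simpa using Complex.abs_im_le_norm τ₀ |>.trans' (le_abs_self _)
    have h4 : ‖τ‖ ≤ ‖τ₀‖ + ‖τ - τ₀‖ := norm_le_insert' τ τ₀
    have hr1 : r ≤ 1 ∨ 1 < r := le_or_gt _ _
    rcases hr1 with hr1 | hr1
    · nlinarith [norm_nonneg (τ - τ₀), norm_nonneg τ₀, norm_nonneg τ]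
    · nlinarith [norm_nonneg (τ - τ₀), norm_nonneg τ₀, norm_nonneg τ]

/-- **Lift + Schwarz.** Under the lifting engine: if `f` is holomorphic on `ball c R` omitting `0, 1`,
`τ₀ ∈ ℍ` lifts `f c`, `0 ≤ r < 1` and `dist z c ≤ r R`, then `f z = λ τ` for some `τ ∈ ℍ` confined
hyperbolically near `τ₀`: `(1 - r) Im τ₀ ≤ (1 + r) Im τ` and `‖τ‖ (1 - r) ≤ ‖τ₀‖ (1 + r)`. [folklore] -/
theorem schottky_exists_confined_preimage
    (hL : ∀ (f : ℂ → ℂ) (c : ℂ) (R : ℝ), 0 < R → DifferentiableOn ℂ f (ball c R) →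
      (∀ z ∈ ball c R, f z ≠ 0) → (∀ z ∈ ball c R, f z ≠ 1) →
      ∀ τ₀ : ℂ, 0 < τ₀.im → modularLambda τ₀ = f c →
      ∃ F : ℂ → ℂ, DifferentiableOn ℂ F (ball c R) ∧ (∀ z ∈ ball c R, 0 < (F z).im) ∧ F c = τ₀ ∧
        ∀ z ∈ ball c R, modularLambda (F z) = f z)
    {f : ℂ → ℂ} {c : ℂ}
    {R r : ℝ} (hR : 0 < R) (hf : DifferentiableOn ℂ f (ball c R)) (h0 : ∀ z ∈ ball c R, f z ≠ 0)
    (h1 : ∀ z ∈ ball c R, f z ≠ 1) {τ₀ : ℂ} (hτ₀ : 0 < τ₀.im) (hl : modularLambda τ₀ = f c)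
    (hr0 : 0 ≤ r) (hr1 : r < 1) {z : ℂ} (hz : dist z c ≤ r * R) :
    ∃ τ : ℂ, 0 < τ.im ∧ modularLambda τ = f z ∧ (1 - r) * τ₀.im ≤ (1 + r) * τ.im ∧
      ‖τ‖ * (1 - r) ≤ ‖τ₀‖ * (1 + r) := by
  obtain ⟨F, hF, hFim, hFc, hFl⟩ := hL f c R hR hf h0 h1 τ₀ hτ₀ hl
  have hzb : z ∈ ball c R := by
    rw [mem_ball]
    calc dist z c ≤ r * R := hz
      _ < 1 * R := by gcongr
      _ = R := one_mul R
  -- the Cayley-type quotient `G = (F - τ₀)/(F - conj τ₀)` maps the ball into the closed unit disc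
  set G : ℂ → ℂ := fun w => (F w - τ₀) / (F w - (starRingEnd ℂ) τ₀) with hGdef
  have hden : ∀ w ∈ ball c R, F w - (starRingEnd ℂ) τ₀ ≠ 0 := by
    intro w hw h
    have := congrArg Complex.im h
    simp only [sub_im, Complex.conj_im, zero_im] at this
    linarith [hFim w hw]
  have hGd : DifferentiableOn ℂ G (ball c R) :=
    (hF.sub_const _).div (hF.sub_const _) hden
  have hGc : G c = 0 := by simp only [hGdef, hFc, sub_self, zero_div]
  have hmaps : MapsTo G (ball c R) (closedBall (G c) 1) := by
    intro w hw
    rw [hGc, mem_closedBall, dist_zero_right, hGdef]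
    dsimp only
    rw [norm_div, div_le_one (norm_pos_iff.2 (hden w hw))]
    exact schottky_norm_sub_le_norm_sub_conj (hFim w hw) hτ₀
  have hS := Complex.dist_le_div_mul_dist_of_mapsTo_ball hGd hmaps hzb
  rw [hGc, dist_zero_right] at hS
  have hGz : ‖G z‖ ≤ r := by
    refine hS.trans ?_
    calc 1 / R * dist z c ≤ 1 / R * (r * R) := by gcongr
      _ = r := by field_simp
  have hkey : ‖F z - τ₀‖ ≤ r * ‖F z - (starRingEnd ℂ) τ₀‖ := by
    have hpos : 0 < ‖F z - (starRingEnd ℂ) τ₀‖ := norm_pos_iff.2 (hden z hzb)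
    rw [hGdef] at hGz
    dsimp only at hGz
    rwa [norm_div, div_le_iff₀ hpos] at hGz
  exact ⟨F z, hFim z hzb, hFl z hzb, schottky_confine_of_le (hFim z hzb) hτ₀ hr0 hkey⟩

/-! ### Schottky's theorem -/

/-- **Schottky's theorem from the three λ-engines** (lifting on discs, compact preimages, the cusp
at `i∞`): for all `α` and `r < 1` there is `C` such that every `f` holomorphic on a disc `ball c R`,
omitting `0` and `1`, with `‖f c‖ ≤ α`, satisfies `‖f z‖ ≤ C` whenever `dist z c ≤ r R`.  Proof: lift
`f = λ ∘ F` with `F c = τ₀`; by the Schwarz lemma for `(F - τ₀)/(F - conj τ₀)` the point `F z` lies in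
the hyperbolic disc of radius `artanh r` about `τ₀`; if `f c` is within `ε'` of a puncture the lift
starts (for `f` or `1 - f`) above height `B` and stays above the height where `‖λ‖ < 1`; otherwise
`τ₀` ranges over a compact set of lifts and `F z` over a compact subset of `ℍ`, where `λ` is bounded.
[cite: Conway1978, Ch. XII §3 (Schottky's theorem)] -/
theorem schottky_of_lambda
    (hL : ∀ (f : ℂ → ℂ) (c : ℂ) (R : ℝ), 0 < R → DifferentiableOn ℂ f (ball c R) →
      (∀ z ∈ ball c R, f z ≠ 0) → (∀ z ∈ ball c R, f z ≠ 1) →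
      ∀ τ₀ : ℂ, 0 < τ₀.im → modularLambda τ₀ = f c →
      ∃ F : ℂ → ℂ, DifferentiableOn ℂ F (ball c R) ∧ (∀ z ∈ ball c R, 0 < (F z).im) ∧ F c = τ₀ ∧
        ∀ z ∈ ball c R, modularLambda (F z) = f z)
    (hK : ∀ K : Set ℂ, IsCompact K → (∀ w ∈ K, w ≠ 0 ∧ w ≠ 1) →
      ∃ K' : Set ℂ, IsCompact K' ∧ (∀ τ ∈ K', 0 < τ.im) ∧ ∀ w ∈ K, ∃ τ ∈ K', modularLambda τ = w)
    (hV : ∀ B : ℝ, ∃ ε > (0:ℝ), ∀ w : ℂ, w ≠ 0 → ‖w‖ < ε →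
      ∃ τ : ℂ, B ≤ τ.im ∧ 0 < τ.im ∧ modularLambda τ = w) :
    ∀ α r : ℝ, r < 1 → ∃ C : ℝ, ∀ (f : ℂ → ℂ) (c : ℂ) (R : ℝ), 0 < R →
      DifferentiableOn ℂ f (ball c R) → (∀ z ∈ ball c R, f z ≠ 0) → (∀ z ∈ ball c R, f z ≠ 1) →
      ‖f c‖ ≤ α → ∀ z : ℂ, dist z c ≤ r * R → ‖f z‖ ≤ C := by
  intro α r hr
  -- WLOG `0 ≤ r`
  set r' : ℝ := max r 0 with hr'def
  have hr'0 : 0 ≤ r' := le_max_right _ _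
  have hr'1 : r' < 1 := max_lt hr one_pos
  have h1r : 0 < 1 - r' := by linarith
  have h1r' : 0 < 1 + r' := by linarith
  -- the cusp: `‖λ‖ < 1` above height `B₁`; lifts starting above `B` stay above `B₁`
  obtain ⟨B₁, hB₁⟩ := exists_forall_norm_modularLambda_lt (zero_lt_one' ℝ)
  set B : ℝ := max B₁ 1 * (1 + r') / (1 - r') with hBdef
  obtain ⟨ε, hε, hVε⟩ := hV B
  set ε' : ℝ := min ε (1 / 2) with hε'def
  have hε' : 0 < ε' := lt_min hε (by norm_num)
  -- the compact middle region of centre values and a compact set of lifts for it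
  set K : Set ℂ := {w : ℂ | ε' ≤ ‖w‖ ∧ ‖w‖ ≤ α ∧ ε' ≤ ‖w - 1‖} with hKdef
  have hKc : IsCompact K := by
    refine (isCompact_closedBall (0 : ℂ) α).of_isClosed_subset ?_ ?_
    · refine (isClosed_le continuous_const continuous_norm).inter
        ((isClosed_le continuous_norm continuous_const).inter
          (isClosed_le continuous_const (continuous_norm.comp (continuous_id.sub continuous_const))))
    · intro w hw
      simpa using hw.2.1
  have hK01 : ∀ w ∈ K, w ≠ 0 ∧ w ≠ 1 := by
    intro w hw
    refine ⟨fun h => ?_, fun h => ?_⟩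
    · have := hw.1; rw [h, norm_zero] at this; linarith
    · have := hw.2.2; rw [h, sub_self, norm_zero] at this; linarith
  obtain ⟨K', hK'c, hK'im, hK'cov⟩ := hK K hKc hK01
  have hm : ∃ m > (0 : ℝ), ∀ τ ∈ K', m ≤ τ.im := by
    rcases K'.eq_empty_or_nonempty with h | h
    · exact ⟨1, one_pos, by simp [h]⟩
    · obtain ⟨τm, hτm, hmin⟩ := hK'c.exists_isMinOn h Complex.continuous_im.continuousOn
      exact ⟨τm.im, hK'im τm hτm, fun τ hτ => hmin hτ⟩
  obtain ⟨m, hm0, hm⟩ := hm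
  obtain ⟨Mτ, hMτ⟩ := hK'c.isBounded.subset_closedBall 0
  set M₂ : ℝ := max Mτ 0 * (1 + r') / (1 - r') with hM₂def
  set K₂ : Set ℂ := closedBall (0 : ℂ) M₂ ∩ {τ : ℂ | m * (1 - r') / (1 + r') ≤ τ.im} with hK₂def
  have hK₂c : IsCompact K₂ :=
    (isCompact_closedBall _ _).inter_right (isClosed_le continuous_const Complex.continuous_im)
  have hK₂im : K₂ ⊆ {τ : ℂ | 0 < τ.im} := by
    intro τ hτ
    have : 0 < m * (1 - r') / (1 + r') := by positivity
    exact this.trans_le hτ.2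
  obtain ⟨C₁, hC₁⟩ := hK₂c.exists_bound_of_continuousOn (continuousOn_modularLambda.mono hK₂im)
  refine ⟨max C₁ 2, ?_⟩
  intro f c R hR hf h0 h1 hfc z hz
  have hz' : dist z c ≤ r' * R := hz.trans (by gcongr; exact le_max_left _ _)
  have hc : c ∈ ball c R := mem_ball_self hR
  -- three cases for the centre value `f c`
  by_cases hA : ‖f c‖ < ε'
  · -- near the puncture 0: lift high, stay high, `‖f z‖ < 1`
    obtain ⟨τ₀, hτ₀B, hτ₀, hl⟩ := hVε (f c) (h0 c hc) (hA.trans_le (min_le_left _ _))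
    obtain ⟨τ, hτ, hτl, hconf, -⟩ :=
      schottky_exists_confined_preimage hL hR hf h0 h1 hτ₀ hl hr'0 hr'1 hz'
    have hτB₁ : B₁ ≤ τ.im := by
      have hB1 : max B₁ 1 ≤ B * (1 - r') / (1 + r') := by
        rw [hBdef]; field_simp; exact le_refl _
      have : B * (1 - r') / (1 + r') ≤ τ.im := by
        rw [div_le_iff₀ h1r']
        nlinarith [hτ₀B, hconf, h1r.le]
      linarith [le_max_left B₁ 1]
    have := hB₁ τ hτB₁
    rw [hτl] at this
    linarith [le_max_right C₁ 2]
  by_cases hB' : ‖f c - 1‖ < ε'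
  · -- near the puncture 1: the same for `g = 1 - f`, then `‖f z‖ < 2`
    set g : ℂ → ℂ := fun w => 1 - f w with hgdef
    have hg : DifferentiableOn ℂ g (ball c R) := (differentiableOn_const 1).sub hf
    have hg0 : ∀ w ∈ ball c R, g w ≠ 0 := fun w hw h => h1 w hw (by
      rw [hgdef, sub_eq_zero] at h; exact h.symm)
    have hg1 : ∀ w ∈ ball c R, g w ≠ 1 := fun w hw h => h0 w hw (by
      rw [hgdef] at h; linear_combination -h)
    have hgc : ‖g c‖ < ε := by
      rw [hgdef]; dsimp only; rw [norm_sub_rev]; exact hB'.trans_le (min_le_left _ _)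
    obtain ⟨τ₀, hτ₀B, hτ₀, hl⟩ := hVε (g c) (hg0 c hc) hgc
    obtain ⟨τ, hτ, hτl, hconf, -⟩ :=
      schottky_exists_confined_preimage hL hR hg hg0 hg1 hτ₀ hl hr'0 hr'1 hz'
    have hτB₁ : B₁ ≤ τ.im := by
      have hB1 : max B₁ 1 ≤ B * (1 - r') / (1 + r') := by
        rw [hBdef]; field_simp; exact le_refl _
      have : B * (1 - r') / (1 + r') ≤ τ.im := by
        rw [div_le_iff₀ h1r']
        nlinarith [hτ₀B, hconf, h1r.le]
      linarith [le_max_left B₁ 1]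
    have hgz := hB₁ τ hτB₁
    rw [hτl] at hgz
    have : ‖f z‖ ≤ ‖(1 : ℂ)‖ + ‖g z‖ := by
      have : f z = 1 - g z := by rw [hgdef]; ring
      rw [this]; exact norm_sub_le _ _
    rw [norm_one] at this
    linarith [le_max_right C₁ 2]
  · -- the compact middle region
    have hwK : f c ∈ K := ⟨not_lt.1 hA, hfc, not_lt.1 hB'⟩
    obtain ⟨τ₀, hτ₀K, hl⟩ := hK'cov (f c) hwK
    have hτ₀ := hK'im τ₀ hτ₀K
    obtain ⟨τ, hτ, hτl, hconf, hnorm⟩ :=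
      schottky_exists_confined_preimage hL hR hf h0 h1 hτ₀ hl hr'0 hr'1 hz'
    have hτ₀n : ‖τ₀‖ ≤ max Mτ 0 := by
      have := hMτ hτ₀K
      rw [mem_closedBall, dist_zero_right] at this
      exact this.trans (le_max_left _ _)
    have hτK₂ : τ ∈ K₂ := by
      refine ⟨?_, ?_⟩
      · rw [mem_closedBall, dist_zero_right, hM₂def, le_div_iff₀ h1r]
        nlinarith [hnorm, hτ₀n, h1r'.le, norm_nonneg τ]
      · show m * (1 - r') / (1 + r') ≤ τ.im
        rw [div_le_iff₀ h1r']
        nlinarith [hm τ₀ hτ₀K, hconf, h1r.le]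
    have := hC₁ τ hτK₂
    rw [hτl] at this
    exact this.trans (le_max_left _ _)

/-- **stub_schottky** (engine, classical — Schottky's theorem, F. Schottky 1904; Conway,
*Functions of One Complex Variable I* (1978), Ch. XII §3; Ahlfors, *Complex Analysis*, Ch. 8 §3):
for all `α` and `r < 1` there is `C` such that every function holomorphic on a disc `ball c R`
that omits the values `0` and `1` and has `‖f c‖ ≤ α` satisfies `‖f z‖ ≤ C` for `dist z c ≤ r R`.
Proved from the tree's universal covering `λ : ℍ → ℂ ∖ {0,1}` via the three landed λ-engine stubs.
[cite: Conway1978, Ch. XII §3] -/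
theorem stub_schottky :
    ∀ α r : ℝ, r < 1 → ∃ C : ℝ, ∀ (f : ℂ → ℂ) (c : ℂ) (R : ℝ), 0 < R →
      DifferentiableOn ℂ f (ball c R) → (∀ z ∈ ball c R, f z ≠ 0) → (∀ z ∈ ball c R, f z ≠ 1) →
      ‖f c‖ ≤ α → ∀ z : ℂ, dist z c ≤ r * R → ‖f z‖ ≤ C :=
  schottky_of_lambda stub_lambdaLiftBall stub_lambdaCompactPreimage stub_lambdaSmallValues

end Summit.CriticalPhenomena.CardyFormulaZ2.Cruxes.UniformAnalyticExtension.Birth
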